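import Mathlib
import HarnessLib
import Summits.NavierStokesRegularity.NavierStokesRegularity.Theorems.HalfSpaceWindowDoorCirculationCarryingRigidityEddyTorqueStrata
import Summits.NavierStokesRegularity.NavierStokesRegularity.Theorems.HalfSpaceWindowDoorCirculationCarryingRigidityTimeOnlyOutflow

/-!
# Route `HalfSpaceWindowDoor`, crux `CirculationCarryingRigidity` (stmt-NavierStokesRegularity-25311) — SECOND CENSUS THEOREM
# IN THE TIME-ONLY CLASS: below the explicit threshold `C < √2`, eddy spin-down alone forces a poloidal profile

Line `eddy_torque` (LEAD ns-hsw-p1 g5).  In the door class `‖v(·,t)‖ ≤ C/√(−t)` the mean swirl velocity `V = Γ/(2πr)`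
obeys, off the axis (`…TimeOnlyVEquation.V_law`),

  `∂ₛV + ⟨v⟩_θ·∇V − ΔV = (2πr)⁻¹ℛ − (1 + r v̄_r)·V/r²`.

The damping `−V/r²` beats the mean-INFLOW term `−v̄_r V/r ≤ (C/√(−s))·V/r` exactly up to the AM–GM bound
`C/(r√(−s)) − 1/r² ≤ C²/(4(−s))`; so under eddy SPIN-DOWN `ℛ ≤ 0` and the sign `ω₃ ≥ 0` (`V ≥ 0`) the weighted quantity
`U = (−s)^{C²/4}·V` is a bounded continuous SUBSOLUTION with bounded drift, and `sup U(s₀,·) ≤ C(−s₀)^{C²/4 − 1/2} → 0` as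
`s₀ → −∞` precisely when `C² < 2`.  The whole-space maximum principle (`…WholeSpaceMaxPrinciple.le_of_subsolution`) then gives:

  **Theorem** (`inner_curl_e3_eq_zero_of_spinDown_of_sq_lt_two`).  A door-class profile with class constant `C² < 2`, the
  sign `ω₃ ≥ 0`, and eddy spin-down `ℛ(r,z,s) ≤ 0` on every axis circle is POLOIDAL (`ω₃ ≡ 0`) — no outflow hypothesis and no
  axis-Type-I bound.  The threshold `√2` is explicit and non-perturbative (the tree's unconditional small-data Liouville
  theorem `…ForwardSmallness.eq_zero_of_frequently_small` has an implicit ε); above it the mean-inflow term is the named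
  obstruction of this method.

All statements concern HYPOTHETICAL blow-up profiles; nothing here is a regularity claim for Navier–Stokes.  The crux itself
stays open.
-/

set_option linter.dupNamespace false
set_option autoImplicit false

namespace Summit.NavierStokesRegularity.NavierStokesRegularity.Theorems.HalfSpaceWindowDoorCirculationCarryingRigidityTimeOnlySpinDown

open Set Filter Topology Function
open scoped Laplacian RealInnerProductSpace ContDiff Classical
open Literature.Analysis Literature.Analysis.FluidPDE
open Summit.NavierStokesRegularity.NavierStokesRegularity.Theorems.AxisTwistDoorAveragedConeLiouvilleDefs
  (cylPt eT e3 circ vortCirc radVortCirc meanR meanZ remainder SignE3)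
open Summit.NavierStokesRegularity.NavierStokesRegularity.Theorems.AveragedConeLiouville.CircMonotone (circ_nonneg)
open Summit.NavierStokesRegularity.NavierStokesRegularity.Theorems.HalfSpaceWindowDoorCirculationCarryingRigidityAxisCirculation
open Summit.NavierStokesRegularity.NavierStokesRegularity.Theorems.HalfSpaceWindowDoorCirculationCarryingRigidityEddyTorqueStrata
  (abs_meanR_le)
open Summit.NavierStokesRegularity.NavierStokesRegularity.Theorems.HalfSpaceWindowDoorCirculationCarryingRigidityTimeOnlyVEquation
  (hasDerivAt_V_time V_law)
open Summit.NavierStokesRegularity.NavierStokesRegularity.Theorems.HalfSpaceWindowDoorCirculationCarryingRigidityTimeOnlyOutflow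
  (V_le V_nonneg continuousOn_V)
open Summit.NavierStokesRegularity.NavierStokesRegularity.Theorems.HalfSpaceWindowDoorCirculationCarryingRigidityWholeSpaceMaxPrinciple
  (le_of_subsolution)
open Summit.NavierStokesRegularity.NavierStokesRegularity.Theorems.HalfSpaceWindowDoorCirculationCarryingRigidityEddyTorqueOneSidedLiouville
  (poloidal_of_circF_eq_zero)
open Summit.NavierStokesRegularity.NavierStokesRegularity.Theorems.PoloidalWindowDoorPoloidalWindowRigidityClassSpaceTimeRates
  (exists_fderiv_rate_of_class')
open Summit.NavierStokesRegularity.NavierStokesRegularity.Theorems.PoloidalWindowDoorPoloidalWindowRigidityLargeScaleEnergyBootstrapLevels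
  (typeI_const_nonneg)

variable {C : ℝ} {v : ℝ → EuclideanSpace ℝ (Fin 3) → EuclideanSpace ℝ (Fin 3)}

/-! ### The AM–GM bound: damping versus mean inflow -/

/-- `C/(r√(−σ)) − 1/r² ≤ C²/(4(−σ))` for `r > 0`, `σ < 0`. -/
theorem inflow_le_damping (C : ℝ) {r σ : ℝ} (hr : 0 < r) (hσ : σ < 0) :
    C / (r * Real.sqrt (-σ)) - 1 / r ^ 2 ≤ C ^ 2 / (4 * (-σ)) := by
  obtain ⟨S, hSdef⟩ : ∃ S, S = Real.sqrt (-σ) := ⟨_, rfl⟩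
  have hs : 0 < S := by rw [hSdef]; exact Real.sqrt_pos.2 (by linarith)
  have hsq : S ^ 2 = -σ := by rw [hSdef]; exact Real.sq_sqrt (by linarith)
  rw [← hSdef, ← hsq]
  have e : C ^ 2 / (4 * S ^ 2) - (C / (r * S) - 1 / r ^ 2) = (C / (2 * S) - 1 / r) ^ 2 := by
    field_simp
    ring
  nlinarith [sq_nonneg (C / (2 * S) - 1 / r), e]

/-! ### The differential inequality for `V` under spin-down -/

/-- **Under eddy spin-down and the sign, `V` is a subsolution up to the rate `C²/(4(−s))`**: off the axis,
`∂ₛV + DV[⟨v⟩_θ] − ΔV ≤ (C²/(4(−s)))·V`. -/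
theorem V_ineq_spinDown (hrate : HasTypeITimeDecay C v)
    (hcont : ContinuousOn (uncurry v) (Iio (0 : ℝ) ×ˢ univ))
    (hmild : ∀ s t : ℝ, s < t → t < 0 → ∀ x,
      v t x = UnboundedOperators.heatExtension (v s) (t - s) x - oseenDuhamel 1 s v v t x)
    (hdiv : ∀ t < 0, VectorCalculus.IsDivFree (v t)) (hsign : SignE3 v)
    (hspin : ∀ s < 0, ∀ r : ℝ, 0 < r → ∀ z : ℝ, remainder v r z s ≤ 0)
    {σ : ℝ} (hσ : σ < 0) {x : EuclideanSpace ℝ (Fin 3)} (hx : cylRadius x ≠ 0) :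
    deriv (fun σ' => (2 * Real.pi)⁻¹ * circ v (cylRadius x) (x 2) σ' / cylRadius x) σ
        + fderiv ℝ (fun y : EuclideanSpace ℝ (Fin 3) => (2 * Real.pi)⁻¹ * circ v (cylRadius y) (y 2) σ / cylRadius y) x
            (angularMeanVec (v σ) x)
        - (Δ (fun y : EuclideanSpace ℝ (Fin 3) => (2 * Real.pi)⁻¹ * circ v (cylRadius y) (y 2) σ / cylRadius y)) x
      ≤ C ^ 2 / (4 * (-σ)) * ((2 * Real.pi)⁻¹ * circ v (cylRadius x) (x 2) σ / cylRadius x) := by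
  have hsm : IsSmoothSpaceTimeOn (Iio (0 : ℝ)) v := isSmoothSpaceTimeOn_of_class hrate hcont hmild hdiv
  have hr : 0 < cylRadius x := lt_of_le_of_ne (cylRadius_nonneg x) (Ne.symm hx)
  have hv1 : ContDiff ℝ 1 (v σ) := (hsm.contDiff_slice hσ).of_le (by norm_cast)
  rw [V_law hrate hcont hmild hdiv hσ hx]
  -- abbreviations
  obtain ⟨Γ, hΓdef⟩ : ∃ Γ, Γ = circ v (cylRadius x) (x 2) σ := ⟨_, rfl⟩
  obtain ⟨R, hRdef⟩ : ∃ R, R = remainder v (cylRadius x) (x 2) σ := ⟨_, rfl⟩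
  obtain ⟨mR, hmRdef⟩ : ∃ mR, mR = meanR v (cylRadius x) (x 2) σ := ⟨_, rfl⟩
  obtain ⟨r, hrdef⟩ : ∃ r, r = cylRadius x := ⟨_, rfl⟩
  rw [← hΓdef, ← hRdef, ← hmRdef, ← hrdef]
  rw [← hrdef] at hr
  have hΓ : 0 ≤ Γ := by rw [hΓdef]; exact circ_nonneg (v := v) hv1 hsign hσ (cylRadius_nonneg x) _
  have hR : R ≤ 0 := by rw [hRdef, ← hrdef]; exact hspin σ hσ r hr (x 2)
  have hmR : |mR| ≤ C / Real.sqrt (-σ) := by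
    rw [hmRdef]
    exact abs_meanR_le fun θ => hrate σ hσ _
  have hmR' : -mR ≤ C / Real.sqrt (-σ) := (neg_le_abs mR).trans hmR
  have hag := inflow_le_damping C hr hσ
  -- `R − mRΓ/r − Γ/r² ≤ Γ·(C/(r√(−σ)) − 1/r²) ≤ Γ·C²/(4(−σ))`
  have h1 : R - mR * Γ / r - Γ / r ^ 2 ≤ Γ * (C ^ 2 / (4 * (-σ))) := by
    have h2 : -(mR * Γ / r) ≤ C / Real.sqrt (-σ) * Γ / r := by
      rw [← neg_div, ← neg_mul]
      exact div_le_div_of_nonneg_right (mul_le_mul_of_nonneg_right hmR' hΓ) hr.le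
    have h3 : C / Real.sqrt (-σ) * Γ / r - Γ / r ^ 2 = Γ * (C / (r * Real.sqrt (-σ)) - 1 / r ^ 2) := by
      field_simp
    have h4 : Γ * (C / (r * Real.sqrt (-σ)) - 1 / r ^ 2) ≤ Γ * (C ^ 2 / (4 * (-σ))) :=
      mul_le_mul_of_nonneg_left hag hΓ
    linarith [h2, h3, h4, hR]
  have hfac : 0 ≤ (2 * Real.pi)⁻¹ * r⁻¹ := by positivity
  calc (2 * Real.pi)⁻¹ * r⁻¹ * (R - mR * Γ / r - Γ / r ^ 2)
      ≤ (2 * Real.pi)⁻¹ * r⁻¹ * (Γ * (C ^ 2 / (4 * (-σ)))) := mul_le_mul_of_nonneg_left h1 hfac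
    _ = C ^ 2 / (4 * (-σ)) * ((2 * Real.pi)⁻¹ * Γ / r) := by ring

/-! ### The weighted maximum principle: `V ≤ 0` when `C² < 2` -/

/-- **`V ≤ 0` under spin-down, the sign and `C² < 2`.**  The weighted quantity `U = (−s)^{C²/4}V` is a bounded continuous
subsolution on every slab `[s₀,t]`, `U(s₀,·) ≤ C(−s₀)^{C²/4}/√(−s₀) → 0` as `s₀ → −∞`. -/
theorem V_nonpos_spinDown (hrate : HasTypeITimeDecay C v)
    (hcont : ContinuousOn (uncurry v) (Iio (0 : ℝ) ×ˢ univ))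
    (hmild : ∀ s t : ℝ, s < t → t < 0 → ∀ x,
      v t x = UnboundedOperators.heatExtension (v s) (t - s) x - oseenDuhamel 1 s v v t x)
    (hdiv : ∀ t < 0, VectorCalculus.IsDivFree (v t)) (hsign : SignE3 v) (hC2 : C ^ 2 < 2)
    (hspin : ∀ s < 0, ∀ r : ℝ, 0 < r → ∀ z : ℝ, remainder v r z s ≤ 0)
    {t : ℝ} (ht : t < 0) (x : EuclideanSpace ℝ (Fin 3)) :
    (2 * Real.pi)⁻¹ * circ v (cylRadius x) (x 2) t / cylRadius x ≤ 0 := by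
  have hsm : IsSmoothSpaceTimeOn (Iio (0 : ℝ)) v := isSmoothSpaceTimeOn_of_class hrate hcont hmild hdiv
  have hC := typeI_const_nonneg hrate
  obtain ⟨K, hK0, hK⟩ := exists_fderiv_rate_of_class' hrate hcont hmild
  set a : ℝ := C ^ 2 / 4 with ha
  have ha0 : 0 ≤ a := by positivity
  -- the weighted maximum principle on `[s₀, t]`
  have hmp : ∀ s₀ < t, (-t) ^ a * ((2 * Real.pi)⁻¹ * circ v (cylRadius x) (x 2) t / cylRadius x) ≤
      (-s₀) ^ a * (C / Real.sqrt (-s₀)) := by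
    intro s₀ hs₀
    have hΛ : 0 ≤ C / Real.sqrt (-t) := by positivity
    refine le_of_subsolution (q := fun σ (y : EuclideanSpace ℝ (Fin 3)) =>
        (-σ) ^ a * ((2 * Real.pi)⁻¹ * circ v (cylRadius y) (y 2) σ / cylRadius y))
      (b := fun σ y => angularMeanVec (v σ) y) (B := (-s₀) ^ a * (C / Real.sqrt (-t))) hΛ ?_ ?_ ?_ ?_
      t (right_mem_Icc.2 hs₀.le) x
    · -- joint continuity
      have hw : Continuous fun p : ℝ × EuclideanSpace ℝ (Fin 3) => (-p.1) ^ a :=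
        (Real.continuous_rpow_const ha0).comp (continuous_neg.comp continuous_fst)
      exact hw.continuousOn.mul (continuousOn_V hsm hK0 hK ht)
    · -- the uniform bound on the slab
      intro σ hσ y
      have hσ0 : σ < 0 := lt_of_le_of_lt hσ.2 ht
      have h1 : (-σ) ^ a ≤ (-s₀) ^ a := Real.rpow_le_rpow (by linarith) (by linarith [hσ.1]) ha0
      have h2 : (2 * Real.pi)⁻¹ * circ v (cylRadius y) (y 2) σ / cylRadius y ≤ C / Real.sqrt (-t) :=
        (V_le hrate hσ0 y).trans
          (div_le_div_of_nonneg_left hC (Real.sqrt_pos.2 (by linarith)) (Real.sqrt_le_sqrt (by linarith [hσ.2])))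
      exact mul_le_mul h1 h2 (V_nonneg hsm hsign hσ0 y) (Real.rpow_nonneg (by linarith) _)
    · -- the initial bound
      intro y
      exact mul_le_mul_of_nonneg_left (V_le hrate (by linarith) y) (Real.rpow_nonneg (by linarith) _)
    · -- the subsolution property on `{U > m}`
      intro σ hσ y hmy
      have hσ0 : σ < 0 := lt_of_le_of_lt hσ.2 ht
      have hnσ : 0 < -σ := by linarith
      have hm0 : 0 ≤ (-s₀) ^ a * (C / Real.sqrt (-s₀)) :=
        mul_nonneg (Real.rpow_nonneg (by linarith) _) (by positivity)
      have hwpos : 0 < (-σ) ^ a := Real.rpow_pos_of_pos hnσ _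
      have hVpos : 0 < (2 * Real.pi)⁻¹ * circ v (cylRadius y) (y 2) σ / cylRadius y := by
        by_contra hle
        have : (-σ) ^ a * ((2 * Real.pi)⁻¹ * circ v (cylRadius y) (y 2) σ / cylRadius y) ≤ 0 :=
          mul_nonpos_of_nonneg_of_nonpos hwpos.le (not_lt.1 hle)
        exact absurd (hm0.trans_lt hmy) (not_lt.2 this)
      have hy : cylRadius y ≠ 0 := by
        intro h0
        rw [h0, div_zero] at hVpos
        exact lt_irrefl _ hVpos
      have hr : 0 < cylRadius y := lt_of_le_of_ne (cylRadius_nonneg y) (Ne.symm hy)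
      -- local smoothness of `V(σ,·)` near `y`
      have hF : ContDiff ℝ 2 fun y' : EuclideanSpace ℝ (Fin 3) => (2 * Real.pi)⁻¹ * circ v (cylRadius y') (y' 2) σ :=
        contDiff_circF ((hsm.contDiff_slice hσ0).of_le (by norm_cast))
      have hVU : ContDiffOn ℝ 2 (fun y' : EuclideanSpace ℝ (Fin 3) =>
          (2 * Real.pi)⁻¹ * circ v (cylRadius y') (y' 2) σ / cylRadius y') {y' | cylRadius y / 2 < cylRadius y'} := by
        refine hF.contDiffOn.div (fun y' hy' => ?_) fun y' hy' => ?_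
        · have : cylRadius y / 2 < cylRadius y' := hy'
          exact (contDiffAt_cylRadius (ne_of_gt (by linarith [cylRadius_nonneg y]))).contDiffWithinAt
        · have : cylRadius y / 2 < cylRadius y' := hy'
          exact ne_of_gt (by linarith [cylRadius_nonneg y])
      have hopen : IsOpen {y' : EuclideanSpace ℝ (Fin 3) | cylRadius y / 2 < cylRadius y'} :=
        isOpen_lt continuous_const continuous_cylRadius
      have hyU : y ∈ {y' : EuclideanSpace ℝ (Fin 3) | cylRadius y / 2 < cylRadius y'} := by
        show cylRadius y / 2 < cylRadius y; linarith
      have hVat : ContDiffAt ℝ 2 (fun y' : EuclideanSpace ℝ (Fin 3) =>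
          (2 * Real.pi)⁻¹ * circ v (cylRadius y') (y' 2) σ / cylRadius y') y := hVU.contDiffAt (hopen.mem_nhds hyU)
      have hVd : DifferentiableAt ℝ (fun y' : EuclideanSpace ℝ (Fin 3) =>
          (2 * Real.pi)⁻¹ * circ v (cylRadius y') (y' 2) σ / cylRadius y') y := hVat.differentiableAt (by norm_num)
      refine ⟨?_, ⟨_, hopen, hyU, contDiffOn_const.mul hVU⟩, ?_⟩
      · have h1 : ‖angularMeanVec (v σ) y‖ ≤ C / Real.sqrt (-σ) :=
          norm_angularMeanVec_le (b := fun _ => C / Real.sqrt (-σ)) (fun x' => hrate σ hσ0 x') y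
        exact h1.trans (div_le_div_of_nonneg_left hC (Real.sqrt_pos.2 (by linarith))
          (Real.sqrt_le_sqrt (by linarith [hσ.2])))
      · -- time derivative of `U(·,y)` and the inequality
        have hVt := hasDerivAt_V_time hsm hσ0 y
        have hw : HasDerivAt (fun τ : ℝ => (-τ) ^ a) (-1 * a * (-σ) ^ (a - 1)) σ :=
          (hasDerivAt_neg σ).rpow_const (Or.inl hnσ.ne')
        refine ⟨_, hw.mul hVt, ?_⟩
        -- `DU[b] = (−σ)^a DV[b]`, `ΔU = (−σ)^a ΔV`
        have hfd : fderiv ℝ (fun y' : EuclideanSpace ℝ (Fin 3) =>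
            (-σ) ^ a * ((2 * Real.pi)⁻¹ * circ v (cylRadius y') (y' 2) σ / cylRadius y')) y (angularMeanVec (v σ) y) =
            (-σ) ^ a * fderiv ℝ (fun y' : EuclideanSpace ℝ (Fin 3) =>
              (2 * Real.pi)⁻¹ * circ v (cylRadius y') (y' 2) σ / cylRadius y') y (angularMeanVec (v σ) y) := by
          rw [fderiv_const_mul hVd, _root_.smul_apply, smul_eq_mul]
        have hlap : (Δ (fun y' : EuclideanSpace ℝ (Fin 3) =>
            (-σ) ^ a * ((2 * Real.pi)⁻¹ * circ v (cylRadius y') (y' 2) σ / cylRadius y'))) y =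
            (-σ) ^ a * (Δ (fun y' : EuclideanSpace ℝ (Fin 3) =>
              (2 * Real.pi)⁻¹ * circ v (cylRadius y') (y' 2) σ / cylRadius y')) y := by
          have e : (fun y' : EuclideanSpace ℝ (Fin 3) =>
              (-σ) ^ a * ((2 * Real.pi)⁻¹ * circ v (cylRadius y') (y' 2) σ / cylRadius y')) =
              (-σ) ^ a • fun y' : EuclideanSpace ℝ (Fin 3) =>
                (2 * Real.pi)⁻¹ * circ v (cylRadius y') (y' 2) σ / cylRadius y' := by
            funext y'; simp [smul_eq_mul]
          rw [e, InnerProductSpace.laplacian_smul _ hVat, smul_eq_mul]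
        rw [hfd, hlap]
        have hineq := V_ineq_spinDown hrate hcont hmild hdiv hsign hspin hσ0 hy
        rw [hVt.deriv] at hineq
        -- `(−σ)^{a−1} = (−σ)^a/(−σ)`
        have hpow : (-σ) ^ (a - 1) = (-σ) ^ a / (-σ) := Real.rpow_sub_one hnσ.ne' a
        rw [hpow]
        have hVnn := hVpos.le
        have hkey : (-σ) ^ a * (C ^ 2 / (4 * (-σ)) *
            ((2 * Real.pi)⁻¹ * circ v (cylRadius y) (y 2) σ / cylRadius y)) =
            a * ((-σ) ^ a / (-σ)) * ((2 * Real.pi)⁻¹ * circ v (cylRadius y) (y 2) σ / cylRadius y) := by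
          rw [ha]
          field_simp
        nlinarith [mul_le_mul_of_nonneg_left hineq hwpos.le, hkey]
  -- let `s₀ → −∞`: `(−s₀)^a · C/√(−s₀) = C (−s₀)^{a − 1/2} → 0` since `a < 1/2`
  have ha12 : 0 < 1 / 2 - a := by rw [ha]; linarith
  have hlim : Tendsto (fun s₀ : ℝ => (-s₀) ^ a * (C / Real.sqrt (-s₀))) atBot (𝓝 0) := by
    have h1 : Tendsto (fun u : ℝ => u ^ (-(1 / 2 - a))) atTop (𝓝 0) := tendsto_rpow_neg_atTop ha12
    have h2 := (h1.comp tendsto_neg_atBot_atTop).const_mul C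
    rw [mul_zero] at h2
    have hev : (fun s₀ : ℝ => C * (fun u : ℝ => u ^ (-(1 / 2 - a))) (-s₀)) =ᶠ[atBot]
        fun s₀ => (-s₀) ^ a * (C / Real.sqrt (-s₀)) := by
      filter_upwards [eventually_lt_atBot (0 : ℝ)] with s₀ hs₀
      have hn : 0 < -s₀ := by linarith
      show C * (-s₀) ^ (-(1 / 2 - a)) = (-s₀) ^ a * (C / Real.sqrt (-s₀))
      rw [Real.sqrt_eq_rpow, show -(1 / 2 - a) = a - 1 / 2 by ring, Real.rpow_sub hn]
      field_simp
    exact h2.congr' hev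
  have hle : (-t) ^ a * ((2 * Real.pi)⁻¹ * circ v (cylRadius x) (x 2) t / cylRadius x) ≤ 0 :=
    ge_of_tendsto hlim ((eventually_lt_atBot t).mono fun s₀ hs₀ => hmp s₀ hs₀)
  have hwpos : 0 < (-t) ^ a := Real.rpow_pos_of_pos (by linarith) _
  by_contra hpos
  have : 0 < (-t) ^ a * ((2 * Real.pi)⁻¹ * circ v (cylRadius x) (x 2) t / cylRadius x) :=
    mul_pos hwpos (not_le.1 hpos)
  linarith

/-- **SECOND CENSUS THEOREM IN THE TIME-ONLY CLASS (explicit threshold).**  A door-class profile with class constant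
`C² < 2` (`‖v(·,t)‖ ≤ C/√(−t)`), the sign `ω₃ ≥ 0`, and eddy SPIN-DOWN `ℛ ≤ 0` on every axis circle (`r > 0`, `s < 0`) is
POLOIDAL: `ω₃ ≡ 0`. -/
theorem inner_curl_e3_eq_zero_of_spinDown_of_sq_lt_two (C : ℝ)
    (v : ℝ → EuclideanSpace ℝ (Fin 3) → EuclideanSpace ℝ (Fin 3))
    (hrate : HasTypeITimeDecay C v)
    (hcont : ContinuousOn (uncurry v) (Iio (0 : ℝ) ×ˢ univ))
    (hmild : ∀ s t : ℝ, s < t → t < 0 → ∀ x,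
      v t x = UnboundedOperators.heatExtension (v s) (t - s) x - oseenDuhamel 1 s v v t x)
    (hdiv : ∀ t < 0, VectorCalculus.IsDivFree (v t))
    (hC2 : C ^ 2 < 2)
    (hsign : ∀ s < 0, ∀ y, 0 ≤ inner ℝ (curl (v s) y) (EuclideanSpace.single (2 : Fin 3) (1 : ℝ)))
    (hspin : ∀ s < 0, ∀ r : ℝ, 0 < r → ∀ z : ℝ, remainder v r z s ≤ 0) :
    ∀ s < 0, ∀ y, inner ℝ (curl (v s) y) (EuclideanSpace.single (2 : Fin 3) (1 : ℝ)) = 0 := by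
  have hsm : IsSmoothSpaceTimeOn (Iio (0 : ℝ)) v := isSmoothSpaceTimeOn_of_class hrate hcont hmild hdiv
  have hsign' : SignE3 v := hsign
  have hF0 : ∀ t < 0, ∀ x : EuclideanSpace ℝ (Fin 3), (2 * Real.pi)⁻¹ * circ v (cylRadius x) (x 2) t = 0 := by
    intro t ht x
    by_cases hx : cylRadius x = 0
    · exact circF_axis v t hx
    have hV := V_nonpos_spinDown hrate hcont hmild hdiv hsign' hC2 hspin ht x
    have hV0 := V_nonneg hsm hsign' ht x
    rcases div_eq_zero_iff.1 (le_antisymm hV hV0) with h | h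
    · exact h
    · exact absurd h hx
  exact poloidal_of_circF_eq_zero hrate hcont hmild hdiv hsign' hF0

end Summit.NavierStokesRegularity.NavierStokesRegularity.Theorems.HalfSpaceWindowDoorCirculationCarryingRigidityTimeOnlySpinDown
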